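import Summits.CriticalPhenomena.PercolationContinuityZ3.Theses.PercBoundarySqueeze
import Literature.Probability.Percolation.GMFiniteSize
import Literature.Probability.Percolation.ConnectivityProofs
import Literature.Probability.Percolation.SharpnessDCTProofs
import Literature.Probability.Percolation.RSW

/-!
# Crux `PercBoundarySqueeze.FreeBoxFatClusterMass` (stmt-CriticalPhenomena-6982): the jump split
# `A ∧ B_∞ ⟹ crux`, and `θ(p_c) = 0 ∧ A ⟹ crux`, `B ⟹ B_∞`

Helper file of the lead prover's line `registered` (skeleton v2, `Cruxes/FreeBoxFatClusterMass/Lines/registered.lean`),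
landed `--supports stmt-CriticalPhenomena-6982`; sorry-free.  It puts the skeleton's COMPOSITION into the tree with the
two registered stubs spelled out as hypotheses (so that the crux closes the moment both stubs land, and so that planners
can cite the bracket  B_∞ ⟸ crux ⟸ A ∧ B_∞  together with `FreeBoxFatClusterMassLine.giantFatMass_of_freeBoxFatClusterMass`).

Notation: `P = P_{p_c}` bond percolation on `ℤ³`, `Λ_R = box 3 R`, `fat_R(x)` = "some finset `T` with `Nat.sqrt (R^3) ≤ #T`
is joined to `x` inside `Λ_R`".
* A   = `∃ c₀ > 0, C: ∀ real s ≥ 1, P(|C(0)| < ∞ ∧ s ≤ |C(0)|) ≤ C s^{-c₀}` (registered stub `stub_finiteClusterTail`);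
* B_∞ = `∃ δ > 0, C: ∀ R ≥ 1, Σ_{x ∈ Λ_R} P(fat_R(x) ∧ |C(x)| = ∞) ≤ C R^{3-δ}` (registered stub `stub_giantFatMass`);
* B   = the same with `x ↔ ∂ⁱⁿΛ_R inside Λ_R` in place of `|C(x)| = ∞` (the birth skeleton's stub `stub_exitFatMass`).

* `JumpSplit.measureReal_fat_le_giant_add_finiteTail` (every `p`, `R ≤ n`):
  `P(fat_n(x)) ≤ P(fat_n(x) ∧ |C(x)| = ∞) + P(|C(0)| < ∞ ∧ R ≤ |C(0)|)` — a fat piece in a finite cluster makes the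
  cluster fat; recentring by translation invariance.
* `freeBoxFatClusterMass_of_finiteClusterTail_of_giantFatMass` : **A → B_∞ → crux** (`δ = min δ_B c₀`,
  `C = C_B⁺ + 27 C_A⁺`, `|Λ_R| ≤ 27 R³`, `⌊R^{3/2}⌋ ≥ R`).
* `giantFatMass_of_continuity` : **θ(p_c) = 0 → B_∞** (every summand is `≤ θ_x(p_c) = θ_0(p_c) = 0`): B_∞ is
  exactly the jump-branch content; hence `freeBoxFatClusterMass_of_continuity_of_finiteClusterTail` : **θ(p_c) = 0 → A → crux**
  (in the real world the crux is the finite-cluster volume tail A and nothing else).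
* `giantFatMass_of_exitFatMass` : **B → B_∞** (an infinite cluster leaves the box through `∂ⁱⁿΛ_R`,
  `toBdry_of_percolatesAt`, on the full-measure event `ω ⊆ E(ℤ³)`).
-/

noncomputable section

namespace Summit.CriticalPhenomena.PercolationContinuityZ3.FreeBoxFatClusterMassLine

open MeasureTheory
open Literature.Probability.Percolation Literature.Probability.LatticeModels
open scoped Classical BigOperators

namespace JumpSplit

/-- **Recentring.**  The event `{|C(x)| < ∞ ∧ s ≤ |C(x)|}` is the translate of
`{|C(0)| < ∞ ∧ s ≤ |C(0)|}`, so both have the same `P_p`-probability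
(`openCluster_relabel_shift`, `bondPercolation_real_preimage_shift`). [folklore] -/
theorem measureReal_finiteTail_shift (p : unitInterval) (s : ℝ) (x : Site 3) :
    (bondPercolation (zdGraph 3) p).real
        {ω | (openCluster ω x).Finite ∧ s ≤ ((openCluster ω x).ncard : ℝ)} =
      (bondPercolation (zdGraph 3) p).real
        {ω | (openCluster ω (0 : Site 3)).Finite ∧ s ≤ ((openCluster ω (0 : Site 3)).ncard : ℝ)} := by
  have hset : {ω : BondConfig (Site 3) | (openCluster ω x).Finite ∧
        s ≤ ((openCluster ω x).ncard : ℝ)} =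
      BondConfig.relabel (sym2Equiv (Site.shift (-x))) ⁻¹'
        {ω | (openCluster ω (0 : Site 3)).Finite ∧
          s ≤ ((openCluster ω (0 : Site 3)).ncard : ℝ)} := by
    ext ω
    simp only [Set.mem_preimage, Set.mem_setOf_eq]
    have h := openCluster_relabel_shift (-x) ω x
    rw [add_neg_cancel] at h
    rw [h, Set.finite_image_iff (add_left_injective (-x)).injOn,
      Set.ncard_image_of_injective _ (add_left_injective (-x))]
  rw [hset, bondPercolation_real_preimage_shift]

/-- **A fat piece inside a finite cluster makes the cluster fat (pointwise).**  If some finset `T`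
with `n ≤ #T`, `R ≤ n`, is joined to `x` inside `Λ_R` and `C(x)` is finite, then `T ⊆ C(x)`, so
`R ≤ |C(x)|`. [folklore] -/
theorem finite_fat_of_fat_piece {R n : ℕ} (hRn : R ≤ n) (x : Site 3) {ω : BondConfig (Site 3)}
    (hE : ∃ T : Finset (Site 3), n ≤ T.card ∧
      ∀ y ∈ T, ω ∈ openConnIn (↑(box 3 R) : Set (Site 3)) x y)
    (hfin : (openCluster ω x).Finite) :
    (R : ℝ) ≤ ((openCluster ω x).ncard : ℝ) := by
  obtain ⟨T, hTcard, hTy⟩ := hE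
  have hTsub : (↑T : Set (Site 3)) ⊆ openCluster ω x := fun y hy =>
    DCT16.reachable_of_pathIn (DCT16.pathIn_of_mem_openConnIn (hTy y (Finset.mem_coe.1 hy)))
  have h1 : T.card ≤ (openCluster ω x).ncard :=
    (Set.ncard_coe_finset T).symm.le.trans (Set.ncard_le_ncard hTsub hfin)
  calc (R : ℝ) ≤ n := by exact_mod_cast hRn
    _ ≤ T.card := by exact_mod_cast hTcard
    _ ≤ ((openCluster ω x).ncard : ℝ) := by exact_mod_cast h1

/-- **The jump split, in measure (every `p`).**  For `x ∈ ℤ³` and `R ≤ n`: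
`P(fat_n(x)) ≤ P(fat_n(x) ∧ |C(x)| = ∞) + P(|C(0)| < ∞ ∧ R ≤ |C(0)|)`. [folklore] -/
theorem measureReal_fat_le_giant_add_finiteTail (p : unitInterval) {R n : ℕ} (hRn : R ≤ n)
    (x : Site 3) :
    (bondPercolation (zdGraph 3) p).real
        {ω | ∃ T : Finset (Site 3), n ≤ T.card ∧
          ∀ y ∈ T, ω ∈ openConnIn (↑(box 3 R) : Set (Site 3)) x y} ≤
      (bondPercolation (zdGraph 3) p).real
        {ω | (∃ T : Finset (Site 3), n ≤ T.card ∧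
            ∀ y ∈ T, ω ∈ openConnIn (↑(box 3 R) : Set (Site 3)) x y) ∧
          (openCluster ω x).Infinite} +
      (bondPercolation (zdGraph 3) p).real
        {ω | (openCluster ω (0 : Site 3)).Finite ∧
          (R : ℝ) ≤ ((openCluster ω (0 : Site 3)).ncard : ℝ)} := by
  set μ := bondPercolation (zdGraph 3) p with hμ
  -- pointwise inclusion
  have hsub : {ω : BondConfig (Site 3) | ∃ T : Finset (Site 3), n ≤ T.card ∧
          ∀ y ∈ T, ω ∈ openConnIn (↑(box 3 R) : Set (Site 3)) x y} ⊆
      {ω | (∃ T : Finset (Site 3), n ≤ T.card ∧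
            ∀ y ∈ T, ω ∈ openConnIn (↑(box 3 R) : Set (Site 3)) x y) ∧
          (openCluster ω x).Infinite} ∪
        {ω | (openCluster ω x).Finite ∧ (R : ℝ) ≤ ((openCluster ω x).ncard : ℝ)} := by
    intro ω hE
    by_cases hinf : (openCluster ω x).Infinite
    · exact Or.inl ⟨hE, hinf⟩
    · have hfin : (openCluster ω x).Finite := Set.not_infinite.1 hinf
      exact Or.inr ⟨hfin, finite_fat_of_fat_piece hRn x hE hfin⟩
  calc μ.real {ω | ∃ T : Finset (Site 3), n ≤ T.card ∧
          ∀ y ∈ T, ω ∈ openConnIn (↑(box 3 R) : Set (Site 3)) x y}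
      ≤ μ.real ({ω | (∃ T : Finset (Site 3), n ≤ T.card ∧
            ∀ y ∈ T, ω ∈ openConnIn (↑(box 3 R) : Set (Site 3)) x y) ∧
          (openCluster ω x).Infinite} ∪
        {ω | (openCluster ω x).Finite ∧ (R : ℝ) ≤ ((openCluster ω x).ncard : ℝ)}) :=
        measureReal_mono hsub
    _ ≤ μ.real {ω | (∃ T : Finset (Site 3), n ≤ T.card ∧
            ∀ y ∈ T, ω ∈ openConnIn (↑(box 3 R) : Set (Site 3)) x y) ∧
          (openCluster ω x).Infinite} +
        μ.real {ω | (openCluster ω x).Finite ∧ (R : ℝ) ≤ ((openCluster ω x).ncard : ℝ)} :=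
        measureReal_union_le _ _
    _ = _ := by rw [measureReal_finiteTail_shift p (R : ℝ) x]

end JumpSplit

open JumpSplit

/-- **A → B_∞ → crux** (the two registered stubs of the line, spelled out).  With
`n = ⌊R^{3/2}⌋ ≥ R ≥ 1`: `Σ_x P(fat_n(x)) ≤ Σ_x P(fat_n(x) ∧ |C(x)| = ∞) + |Λ_R| · P(|C(0)| < ∞ ∧ R ≤ |C(0)|)
≤ C_B R^{3−δ_B} + (2R+1)³ · C_A R^{−c₀} ≤ (C_B⁺ + 27 C_A⁺) · R^{3 − min(δ_B, c₀)}`. -/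
theorem freeBoxFatClusterMass_of_finiteClusterTail_of_giantFatMass :
    (∃ c₀ C : ℝ, 0 < c₀ ∧ ∀ s : ℝ, 1 ≤ s →
      (bondPercolation (zdGraph 3) (criticalProbI 3)).real
        {ω | (openCluster ω (0 : Site 3)).Finite ∧ s ≤ ((openCluster ω (0 : Site 3)).ncard : ℝ)}
        ≤ C * s ^ (-c₀)) →
    (∃ δ C : ℝ, 0 < δ ∧ ∀ R : ℕ, 1 ≤ R →
      ∑ x ∈ box 3 R, (bondPercolation (zdGraph 3) (criticalProbI 3)).real
        {ω | (∃ T : Finset (Site 3), Nat.sqrt (R ^ 3) ≤ T.card ∧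
            ∀ y ∈ T, ω ∈ openConnIn (↑(box 3 R) : Set (Site 3)) x y) ∧
          (openCluster ω x).Infinite}
        ≤ C * (R : ℝ) ^ ((3 : ℝ) - δ)) →
      Summit.CriticalPhenomena.PercolationContinuityZ3.Theses.PercBoundarySqueeze.FreeBoxFatClusterMass := by
  rintro ⟨c₀, CA, hc₀, hA⟩ ⟨δB, CB, hδB, hB⟩
  refine ⟨min δB c₀, max CB 0 + 27 * max CA 0, lt_min hδB hc₀, ?_⟩
  intro R hR
  set μ := bondPercolation (zdGraph 3) (criticalProbI 3) with hμ
  -- numerics of the scale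
  have hρ1 : (1 : ℝ) ≤ R := by exact_mod_cast hR
  have hρ0 : (0 : ℝ) < R := by linarith
  have hR2 : R ^ 2 ≤ R ^ 3 := Nat.pow_le_pow_right hR (by norm_num)
  have hRn : R ≤ Nat.sqrt (R ^ 3) := Nat.le_sqrt.2 (by simpa [sq] using hR2)
  -- the finite-cluster tail at threshold `R`
  have hF0 : μ.real {ω | (openCluster ω (0 : Site 3)).Finite ∧
        (R : ℝ) ≤ ((openCluster ω (0 : Site 3)).ncard : ℝ)} ≤ max CA 0 * (R : ℝ) ^ (-c₀) :=
    (hA (R : ℝ) hρ1).trans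
      (mul_le_mul_of_nonneg_right (le_max_left _ _) (Real.rpow_nonneg hρ0.le _))
  -- exponents and the volume of the box
  have hexpB : (R : ℝ) ^ ((3 : ℝ) - δB) ≤ (R : ℝ) ^ ((3 : ℝ) - min δB c₀) :=
    Real.rpow_le_rpow_of_exponent_le hρ1 (by linarith [min_le_left δB c₀])
  have hexpA : (R : ℝ) ^ (3 : ℝ) * (R : ℝ) ^ (-c₀) ≤ (R : ℝ) ^ ((3 : ℝ) - min δB c₀) := by
    rw [← Real.rpow_add hρ0]
    exact Real.rpow_le_rpow_of_exponent_le hρ1 (by linarith [min_le_right δB c₀])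
  have h3 : (R : ℝ) ^ (3 : ℝ) = (R : ℝ) ^ (3 : ℕ) := by exact_mod_cast Real.rpow_natCast (R : ℝ) 3
  have hcard : ((box 3 R).card : ℝ) ≤ 27 * (R : ℝ) ^ (3 : ℝ) := by
    rw [card_box, h3]
    push_cast
    have h : (2 * (R : ℝ) + 1) ^ 3 ≤ (3 * (R : ℝ)) ^ 3 :=
      pow_le_pow_left₀ (by positivity) (by linarith) 3
    linarith [h]
  -- the two sums
  have hsumB : ∑ x ∈ box 3 R, μ.real
        {ω | (∃ T : Finset (Site 3), Nat.sqrt (R ^ 3) ≤ T.card ∧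
            ∀ y ∈ T, ω ∈ openConnIn (↑(box 3 R) : Set (Site 3)) x y) ∧
          (openCluster ω x).Infinite} ≤
      max CB 0 * (R : ℝ) ^ ((3 : ℝ) - min δB c₀) :=
    (hB R hR).trans
      ((mul_le_mul_of_nonneg_right (le_max_left _ _) (Real.rpow_nonneg hρ0.le _)).trans
        (mul_le_mul_of_nonneg_left hexpB (le_max_right _ _)))
  have hsumA : ((box 3 R).card : ℝ) * μ.real {ω | (openCluster ω (0 : Site 3)).Finite ∧
        (R : ℝ) ≤ ((openCluster ω (0 : Site 3)).ncard : ℝ)} ≤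
      27 * max CA 0 * (R : ℝ) ^ ((3 : ℝ) - min δB c₀) :=
    calc ((box 3 R).card : ℝ) * μ.real {ω | (openCluster ω (0 : Site 3)).Finite ∧
            (R : ℝ) ≤ ((openCluster ω (0 : Site 3)).ncard : ℝ)}
        ≤ (27 * (R : ℝ) ^ (3 : ℝ)) * (max CA 0 * (R : ℝ) ^ (-c₀)) :=
          mul_le_mul hcard hF0 measureReal_nonneg (by positivity)
      _ = 27 * max CA 0 * ((R : ℝ) ^ (3 : ℝ) * (R : ℝ) ^ (-c₀)) := by ring
      _ ≤ 27 * max CA 0 * (R : ℝ) ^ ((3 : ℝ) - min δB c₀) :=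
          mul_le_mul_of_nonneg_left hexpA (by positivity)
  -- assemble
  calc ∑ x ∈ box 3 R, μ.real {ω | ∃ T : Finset (Site 3), Nat.sqrt (R ^ 3) ≤ T.card ∧
          ∀ y ∈ T, ω ∈ openConnIn (↑(box 3 R) : Set (Site 3)) x y}
      ≤ ∑ x ∈ box 3 R, (μ.real
          {ω | (∃ T : Finset (Site 3), Nat.sqrt (R ^ 3) ≤ T.card ∧
              ∀ y ∈ T, ω ∈ openConnIn (↑(box 3 R) : Set (Site 3)) x y) ∧
            (openCluster ω x).Infinite} +
          μ.real {ω | (openCluster ω (0 : Site 3)).Finite ∧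
            (R : ℝ) ≤ ((openCluster ω (0 : Site 3)).ncard : ℝ)}) :=
        Finset.sum_le_sum fun x _ =>
          measureReal_fat_le_giant_add_finiteTail (criticalProbI 3) hRn x
    _ = ∑ x ∈ box 3 R, μ.real
          {ω | (∃ T : Finset (Site 3), Nat.sqrt (R ^ 3) ≤ T.card ∧
              ∀ y ∈ T, ω ∈ openConnIn (↑(box 3 R) : Set (Site 3)) x y) ∧
            (openCluster ω x).Infinite} +
        ((box 3 R).card : ℝ) * μ.real {ω | (openCluster ω (0 : Site 3)).Finite ∧
            (R : ℝ) ≤ ((openCluster ω (0 : Site 3)).ncard : ℝ)} := by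
        rw [Finset.sum_add_distrib, Finset.sum_const, nsmul_eq_mul]
    _ ≤ max CB 0 * (R : ℝ) ^ ((3 : ℝ) - min δB c₀) +
        27 * max CA 0 * (R : ℝ) ^ ((3 : ℝ) - min δB c₀) := add_le_add hsumB hsumA
    _ = (max CB 0 + 27 * max CA 0) * (R : ℝ) ^ ((3 : ℝ) - min δB c₀) := by ring

/-- **B_∞ is vacuous in the orthodox world.**  If `θ(p_c) = 0` then every summand of
B_∞ is `≤ P_{p_c}(|C(x)| = ∞) = θ_x(p_c) = θ_0(p_c) = 0`, so the stub holds with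
`δ = 1`, `C = 0`. [folklore] -/
theorem giantFatMass_of_continuity :
    _root_.PercolationContinuityZ3 →
    (∃ δ C : ℝ, 0 < δ ∧ ∀ R : ℕ, 1 ≤ R →
      ∑ x ∈ box 3 R, (bondPercolation (zdGraph 3) (criticalProbI 3)).real
        {ω | (∃ T : Finset (Site 3), Nat.sqrt (R ^ 3) ≤ T.card ∧
            ∀ y ∈ T, ω ∈ openConnIn (↑(box 3 R) : Set (Site 3)) x y) ∧
          (openCluster ω x).Infinite}
        ≤ C * (R : ℝ) ^ ((3 : ℝ) - δ)) := by
  intro h0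
  refine ⟨1, 0, one_pos, fun R _ => ?_⟩
  set μ := bondPercolation (zdGraph 3) (criticalProbI 3) with hμ
  have hterm : ∀ x : Site 3, μ.real
      {ω | (∃ T : Finset (Site 3), Nat.sqrt (R ^ 3) ≤ T.card ∧
          ∀ y ∈ T, ω ∈ openConnIn (↑(box 3 R) : Set (Site 3)) x y) ∧
        (openCluster ω x).Infinite} ≤ 0 := by
    intro x
    calc μ.real {ω | (∃ T : Finset (Site 3), Nat.sqrt (R ^ 3) ≤ T.card ∧
            ∀ y ∈ T, ω ∈ openConnIn (↑(box 3 R) : Set (Site 3)) x y) ∧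
          (openCluster ω x).Infinite}
        ≤ μ.real (percolatesAt x) := measureReal_mono fun ω hω => hω.2
      _ = theta (zdGraph 3) (0 : Site 3) (criticalProbI 3) :=
          theta_zdGraph_eq_theta_zero (criticalProbI 3) x
      _ = 0 := h0
  calc ∑ x ∈ box 3 R, μ.real
        {ω | (∃ T : Finset (Site 3), Nat.sqrt (R ^ 3) ≤ T.card ∧
            ∀ y ∈ T, ω ∈ openConnIn (↑(box 3 R) : Set (Site 3)) x y) ∧
          (openCluster ω x).Infinite}
      ≤ ∑ x ∈ box 3 R, (0 : ℝ) := Finset.sum_le_sum fun x _ => hterm x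
    _ = 0 * (R : ℝ) ^ ((3 : ℝ) - 1) := by simp

/-- **B ⟹ B_∞** (the reshape weakens the stub).  On the full-measure event `ω ⊆ E(ℤ³)` an infinite
cluster at `x ∈ Λ_R` leaves `Λ_R` through its inner vertex boundary (`toBdry_of_percolatesAt`), so
`{fat_R(x) ∧ |C(x)| = ∞} ⊆ {fat_R(x) ∧ x ↔ ∂ⁱⁿΛ_R in Λ_R}` a.s. [folklore] -/
theorem giantFatMass_of_exitFatMass :
    (∃ δ C : ℝ, 0 < δ ∧ ∀ R : ℕ, 1 ≤ R →
      ∑ x ∈ box 3 R, (bondPercolation (zdGraph 3) (criticalProbI 3)).real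
        {ω | (∃ T : Finset (Site 3), Nat.sqrt (R ^ 3) ≤ T.card ∧
            ∀ y ∈ T, ω ∈ openConnIn (↑(box 3 R) : Set (Site 3)) x y) ∧
          ∃ w ∈ innerBoundary (zdGraph 3) (box 3 R),
            ω ∈ openConnIn (↑(box 3 R) : Set (Site 3)) x w}
        ≤ C * (R : ℝ) ^ ((3 : ℝ) - δ)) →
    (∃ δ C : ℝ, 0 < δ ∧ ∀ R : ℕ, 1 ≤ R →
      ∑ x ∈ box 3 R, (bondPercolation (zdGraph 3) (criticalProbI 3)).real
        {ω | (∃ T : Finset (Site 3), Nat.sqrt (R ^ 3) ≤ T.card ∧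
            ∀ y ∈ T, ω ∈ openConnIn (↑(box 3 R) : Set (Site 3)) x y) ∧
          (openCluster ω x).Infinite}
        ≤ C * (R : ℝ) ^ ((3 : ℝ) - δ)) := by
  rintro ⟨δ, C, hδ, hB⟩
  refine ⟨δ, C, hδ, fun R hR => le_trans (Finset.sum_le_sum fun x hx => ?_) (hB R hR)⟩
  set μ := bondPercolation (zdGraph 3) (criticalProbI 3) with hμ
  have hN : μ {ω : BondConfig (Site 3) | ¬ ω ⊆ (zdGraph 3).edgeSet} = 0 :=
    ae_iff.1 (ae_subset_edgeSet (zdGraph 3) (criticalProbI 3))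
  have hNr : μ.real {ω : BondConfig (Site 3) | ¬ ω ⊆ (zdGraph 3).edgeSet} = 0 :=
    (measureReal_eq_zero_iff).2 hN
  have hsub : {ω : BondConfig (Site 3) | (∃ T : Finset (Site 3), Nat.sqrt (R ^ 3) ≤ T.card ∧
          ∀ y ∈ T, ω ∈ openConnIn (↑(box 3 R) : Set (Site 3)) x y) ∧
        (openCluster ω x).Infinite} ⊆
      {ω | (∃ T : Finset (Site 3), Nat.sqrt (R ^ 3) ≤ T.card ∧
            ∀ y ∈ T, ω ∈ openConnIn (↑(box 3 R) : Set (Site 3)) x y) ∧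
          ∃ w ∈ innerBoundary (zdGraph 3) (box 3 R),
            ω ∈ openConnIn (↑(box 3 R) : Set (Site 3)) x w} ∪
        {ω : BondConfig (Site 3) | ¬ ω ⊆ (zdGraph 3).edgeSet} := by
    rintro ω ⟨hE, hinf⟩
    by_cases hω : ω ⊆ (zdGraph 3).edgeSet
    · exact Or.inl ⟨hE, toBdry_of_percolatesAt hx hω hinf⟩
    · exact Or.inr hω
  calc μ.real {ω | (∃ T : Finset (Site 3), Nat.sqrt (R ^ 3) ≤ T.card ∧
            ∀ y ∈ T, ω ∈ openConnIn (↑(box 3 R) : Set (Site 3)) x y) ∧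
          (openCluster ω x).Infinite}
      ≤ μ.real ({ω | (∃ T : Finset (Site 3), Nat.sqrt (R ^ 3) ≤ T.card ∧
            ∀ y ∈ T, ω ∈ openConnIn (↑(box 3 R) : Set (Site 3)) x y) ∧
          ∃ w ∈ innerBoundary (zdGraph 3) (box 3 R),
            ω ∈ openConnIn (↑(box 3 R) : Set (Site 3)) x w} ∪
        {ω : BondConfig (Site 3) | ¬ ω ⊆ (zdGraph 3).edgeSet}) := measureReal_mono hsub
    _ ≤ μ.real {ω | (∃ T : Finset (Site 3), Nat.sqrt (R ^ 3) ≤ T.card ∧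
            ∀ y ∈ T, ω ∈ openConnIn (↑(box 3 R) : Set (Site 3)) x y) ∧
          ∃ w ∈ innerBoundary (zdGraph 3) (box 3 R),
            ω ∈ openConnIn (↑(box 3 R) : Set (Site 3)) x w} +
        μ.real {ω : BondConfig (Site 3) | ¬ ω ⊆ (zdGraph 3).edgeSet} := measureReal_union_le _ _
    _ = _ := by rw [hNr, add_zero]

/-- **θ(p_c) = 0 ∧ A ⟹ crux**: in the orthodox world the crux is exactly the finite-cluster volume tail A
(B_∞ being vacuous there, `giantFatMass_of_continuity`). -/
theorem freeBoxFatClusterMass_of_continuity_of_finiteClusterTail :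
    _root_.PercolationContinuityZ3 →
    (∃ c₀ C : ℝ, 0 < c₀ ∧ ∀ s : ℝ, 1 ≤ s →
      (bondPercolation (zdGraph 3) (criticalProbI 3)).real
        {ω | (openCluster ω (0 : Site 3)).Finite ∧ s ≤ ((openCluster ω (0 : Site 3)).ncard : ℝ)}
        ≤ C * s ^ (-c₀)) →
      Summit.CriticalPhenomena.PercolationContinuityZ3.Theses.PercBoundarySqueeze.FreeBoxFatClusterMass := fun h0 hA =>
  freeBoxFatClusterMass_of_finiteClusterTail_of_giantFatMass hA (giantFatMass_of_continuity h0)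

end Summit.CriticalPhenomena.PercolationContinuityZ3.FreeBoxFatClusterMassLine

end
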